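import Literature.Analysis.FluidPDE.DriftDiffusionMaxPrinciple
import HarnessLib

/-!
# StrainDoorsThreshold — door family S37 «StrainDoors» (nsreg-p1 g31, ROUND-35): plate E2_S «StrainThreshold»
# in ABSTRACT form — the first-touch / supersolution device for the top Rayleigh quotient
# `Λ(t) = sup_{x, |e|=1} ⟪W(t,x)e, e⟫` of an operator field (twin of `ArgmaxDoorsSupNorm`)

* `rayleigh_le_supersolution_of_argmax_growth` — `W : [0,T] × E → (E →L E)` jointly `C^∞`, `‖W(t,x)‖ → 0`
  uniformly as `|x| → ∞`; `B > 0` continuous with `B' ≥ φB` within `[0,T]`; IF at every `t > 0` and every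
  maximiser `(x̄,ē)` of `⟪W(t,x)e,e⟫` over `E × {|e| = 1}` with `⟪W(t,x̄)ē,ē⟫ > B(t)`:
  `⟪∂ₜW(t,x̄)ē,ē⟫ ≤ φ(t)⟪W(t,x̄)ē,ē⟫, THEN `⟪W(0,·)e,e⟫ ≤ B(0)` propagates: `⟪W(t,x)e,e⟫ ≤ B(t)`.
  For Navier–Stokes `W(t,x) = ∇u(t,x)` and `Λ(t)` = the largest strain eigenvalue; the PDE enters only
  through the user's inequality at the maximiser (plate E1_S «StrainGrowth»).

HONEST FRAME / WHAT THIS IS NOT: a tool for regularity CRITERIA about hypothetical blow-up (S-door lane, LEAD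
ns-s30-p1 g3; `--supports stmt-NavierStokesRegularity-0056 --as helper`); item 0056 `NoTypeII` and NS
regularity are NOT proved; no PDE and no Literature fact inside; nothing here is a route or a summit statement.
-/

noncomputable section

open Set Function Filter Metric MeasureTheory
open scoped RealInnerProductSpace Topology

set_option linter.dupNamespace false

namespace Summit.NavierStokesRegularity.NavierStokesRegularity.Theorems.ArgmaxDoors

open Literature.Analysis.FluidPDE

section AbstractStrain

variable {E : Type*} [NormedAddCommGroup E] [InnerProductSpace ℝ E] [FiniteDimensional ℝ E]

/-- **Threshold comparison for the top Rayleigh quotient of an operator field** (plate E2_S in abstract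
form). Let `W : [0,T] × E → (E →L E)` be jointly `C^∞` on the closed slab with `‖W(t,x)‖ → 0` as `|x| → ∞`
uniformly in `t`; let `B > 0` be continuous on `[0,T]` with one-sided derivative `B'` within `[0,T]` and
`φB ≤ B'`. Suppose that at every `t ∈ (0,T]` and every maximiser `(x̄,ē)`, `|ē| = 1`, of
`(x,e) ↦ ⟪W(t,x)e,e⟫` over `E × {|e|=1}` AT WHICH `⟪W(t,x̄)ē,ē⟫ > B(t)`:
`⟪∂ₜW(t,x̄)ē, ē⟫ ≤ φ(t)⟪W(t,x̄)ē,ē⟫`. If `⟪W(0,x)e,e⟫ ≤ B(0)` for all `x`, `|e| = 1`, then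
`⟪W(t,x)e,e⟫ ≤ B(t)` on the slab. Proof: for `ε > 0`, `ψ = e^{−2εt}⟪We,e⟫/B` attains its maximum over
`[0,T] × E × sphere` (decay + compactness); a maximum value `> 1` sits at `t₀ > 0` at a maximiser above the
threshold; one-sided Fermat in `t` against `B' ≥ φB` gives `0 ≤ ∂ₜψ < 0`. [cite: Friedman1964, Ch. 2 §4
Lemma 5 (the device); folklore] -/
theorem rayleigh_le_supersolution_of_argmax_growth {T : ℝ} {W : ℝ → E → (E →L[ℝ] E)}
    (hW : IsSmoothSpaceTimeOn (Icc 0 T) W)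
    (hunif : ∀ η : ℝ, 0 < η → ∃ R : ℝ, ∀ t ∈ Icc 0 T, ∀ x : E, R ≤ ‖x‖ → ‖W t x‖ ≤ η)
    {B B' φ : ℝ → ℝ} (hBc : ContinuousOn B (Icc 0 T)) (hBpos : ∀ t ∈ Icc 0 T, 0 < B t)
    (hBd : ∀ t ∈ Icc 0 T, HasDerivWithinAt B (B' t) (Icc 0 T) t)
    (hsuper : ∀ t ∈ Icc 0 T, φ t * B t ≤ B' t)
    (hgrow : ∀ t ∈ Icc 0 T, 0 < t → ∀ (x₀ : E) (e₀ : E), ‖e₀‖ = 1 →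
      (∀ (x : E) (e : E), ‖e‖ = 1 → ⟪W t x e, e⟫ ≤ ⟪W t x₀ e₀, e₀⟫) → B t < ⟪W t x₀ e₀, e₀⟫ →
      ⟪timeDerivWithin (Icc 0 T) W t x₀ e₀, e₀⟫ ≤ φ t * ⟪W t x₀ e₀, e₀⟫)
    (hM : ∀ (x : E) (e : E), ‖e‖ = 1 → ⟪W 0 x e, e⟫ ≤ B 0) :
    ∀ t ∈ Icc 0 T, ∀ (x : E) (e : E), ‖e‖ = 1 → ⟪W t x e, e⟫ ≤ B t := by
  by_cases hT : T < 0
  · intro t ht; exact absurd (ht.1.trans ht.2) (not_le.2 hT)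
  push Not at hT
  have h0T : (0 : ℝ) ∈ Icc 0 T := ⟨le_rfl, hT⟩
  obtain ⟨tm, htm, hmin⟩ := (isCompact_Icc (a := (0 : ℝ)) (b := T)).exists_isMinOn ⟨0, h0T⟩ hBc
  set b : ℝ := B tm with hb
  have hbpos : 0 < b := hBpos tm htm
  have hBge : ∀ t ∈ Icc 0 T, b ≤ B t := fun t ht => isMinOn_iff.mp hmin t ht
  -- `|⟪L e, e⟫| ≤ ‖L‖` for unit `e`
  have hray : ∀ (L : E →L[ℝ] E) (e : E), ‖e‖ = 1 → ⟪L e, e⟫ ≤ ‖L‖ := fun L e he => by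
    calc ⟪L e, e⟫ ≤ ‖L e‖ * ‖e‖ := real_inner_le_norm _ _
      _ ≤ ‖L‖ * ‖e‖ * ‖e‖ := by gcongr; exact L.le_opNorm e
      _ = ‖L‖ := by rw [he, mul_one, mul_one]
  suffices key : ∀ ε : ℝ, 0 < ε →
      ∀ t ∈ Icc 0 T, ∀ (x : E) (e : E), ‖e‖ = 1 → Real.exp (-(2 * ε * t)) * ⟪W t x e, e⟫ / B t ≤ 1 by
    intro t ht x e he
    have hBt : 0 < B t := hBpos t ht
    have hlim : ⟪W t x e, e⟫ / B t ≤ 1 := by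
      have hc : Continuous fun ε : ℝ => Real.exp (-(2 * ε * t)) * ⟪W t x e, e⟫ / B t := by fun_prop
      have h0 : Tendsto (fun ε : ℝ => Real.exp (-(2 * ε * t)) * ⟪W t x e, e⟫ / B t) (𝓝[>] 0)
          (𝓝 (⟪W t x e, e⟫ / B t)) := by
        have := (hc.tendsto 0).mono_left (nhdsWithin_le_nhds (s := Ioi (0 : ℝ)))
        simpa using this
      exact le_of_tendsto h0 (eventually_nhdsWithin_of_forall fun ε hε => key ε hε t ht x e he)
    rwa [div_le_one hBt] at hlim
  intro ε hε
  by_contra hcon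
  push Not at hcon
  obtain ⟨t₁, ht₁, x₁, e₁, he₁, hlt⟩ := hcon
  set w : ℝ → ℝ := fun t => Real.exp (-(2 * ε * t)) with hw
  have hwpos : ∀ t, 0 < w t := fun t => Real.exp_pos _
  have hwle : ∀ t ∈ Icc (0 : ℝ) T, w t ≤ 1 := fun t ht => by
    rw [hw, Real.exp_le_one_iff]; nlinarith [ht.1, hε]
  set ψ : ℝ × E × E → ℝ := fun z => w z.1 * ⟪W z.1 z.2.1 z.2.2, z.2.2⟫ / B z.1 with hψ
  set S' : ℝ := w t₁ * ⟪W t₁ x₁ e₁, e₁⟫ / B t₁ with hS'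
  have hS'pos : 0 < S' := zero_lt_one.trans hlt
  -- outside a large ball (in `x`) the weighted quotient is `< S'`
  obtain ⟨R, hR⟩ := hunif (b * S' / 2) (by positivity)
  have hout : ∀ t ∈ Icc 0 T, ∀ (x : E) (e : E), ‖e‖ = 1 → R ≤ ‖x‖ →
      w t * ⟪W t x e, e⟫ / B t < S' := by
    intro t ht x e he hx
    have hBt : 0 < B t := hBpos t ht
    have h1 : ⟪W t x e, e⟫ ≤ b * S' / 2 := (hray _ e he).trans (hR t ht x hx)
    have h2 : w t * ⟪W t x e, e⟫ ≤ 1 * (b * S' / 2) := by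
      rcases le_or_gt 0 ⟪W t x e, e⟫ with h | h
      · exact mul_le_mul (hwle t ht) h1 h (by norm_num)
      · have : w t * ⟪W t x e, e⟫ < 0 := mul_neg_of_pos_of_neg (hwpos t) h
        have : 0 ≤ b * S' / 2 := by positivity
        linarith
    calc w t * ⟪W t x e, e⟫ / B t ≤ (b * S' / 2) / B t := by
          rw [one_mul] at h2; exact div_le_div_of_nonneg_right h2 hBt.le
      _ ≤ (B t * S' / 2) / B t := by gcongr; exact hBge t ht
      _ = S' / 2 := by field_simp
      _ < S' := by linarith
  -- the maximum over the compact part is attained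
  set R' : ℝ := max R ‖x₁‖ with hR'
  set K : Set (ℝ × E × E) := Icc 0 T ×ˢ (closedBall (0 : E) R' ×ˢ sphere (0 : E) 1) with hK
  have hKc : IsCompact K := isCompact_Icc.prod ((isCompact_closedBall _ _).prod (isCompact_sphere _ _))
  have h1K : (t₁, x₁, e₁) ∈ K := mk_mem_prod ht₁ (mk_mem_prod (by simp [hR']) (by simpa using he₁))
  have hψc : ContinuousOn ψ K := by
    have hWc : ContinuousOn (fun z : ℝ × E × E => W z.1 z.2.1) K := by
      have h := hW.continuousOn
      have h2 : ContinuousOn (fun z : ℝ × E × E => (z.1, z.2.1)) K := by fun_prop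
      exact h.comp h2 fun z hz => mk_mem_prod (mem_prod.mp hz).1 (mem_univ _)
    have hev : ContinuousOn (fun z : ℝ × E × E => W z.1 z.2.1 z.2.2) K :=
      isBoundedBilinearMap_apply.continuous.comp_continuousOn (hWc.prodMk (by fun_prop))
    have hin : ContinuousOn (fun z : ℝ × E × E => ⟪W z.1 z.2.1 z.2.2, z.2.2⟫) K :=
      hev.inner (by fun_prop)
    have hec : Continuous fun z : ℝ × E × E => w z.1 := by fun_prop
    have hBK : ContinuousOn (fun z : ℝ × E × E => B z.1) K :=
      hBc.comp continuous_fst.continuousOn fun z hz => (mem_prod.mp hz).1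
    exact (hec.continuousOn.mul hin).div hBK fun z hz => (hBpos z.1 (mem_prod.mp hz).1).ne'
  obtain ⟨⟨t₀, x₀, e₀⟩, h0K, hmaxK⟩ := hKc.exists_isMaxOn ⟨(t₁, x₁, e₁), h1K⟩ hψc
  have ht₀ : t₀ ∈ Icc 0 T := (mem_prod.mp h0K).1
  have he₀ : ‖e₀‖ = 1 := by
    have := (mem_prod.mp (mem_prod.mp h0K).2).2
    simpa using this
  have hB₀ : 0 < B t₀ := hBpos t₀ ht₀
  have hS'le : S' ≤ w t₀ * ⟪W t₀ x₀ e₀, e₀⟫ / B t₀ := isMaxOn_iff.mp hmaxK (t₁, x₁, e₁) h1K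
  -- a maximum over the whole of `[0,T] × E × sphere`
  have hglob : ∀ t ∈ Icc 0 T, ∀ (x : E) (e : E), ‖e‖ = 1 →
      w t * ⟪W t x e, e⟫ / B t ≤ w t₀ * ⟪W t₀ x₀ e₀, e₀⟫ / B t₀ := by
    intro t ht x e he
    by_cases hx : ‖x‖ ≤ R'
    · exact isMaxOn_iff.mp hmaxK (t, x, e)
        (mk_mem_prod ht (mk_mem_prod (by simpa using hx) (by simpa using he)))
    · have hRx : R ≤ ‖x‖ := (le_max_left _ _).trans (not_le.mp hx).le
      exact ((hout t ht x e he hRx).trans_le hS'le).le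
  -- `t₀ > 0`
  have ht₀pos : 0 < t₀ := by
    rcases ht₀.1.eq_or_lt with h | h
    · exfalso
      have hB00 : 0 < B 0 := hBpos 0 h0T
      have h1 : w t₀ * ⟪W t₀ x₀ e₀, e₀⟫ / B t₀ ≤ 1 := by
        rw [← h, hw]
        simp only [mul_zero, neg_zero, Real.exp_zero, one_mul]
        rw [div_le_one hB00]
        exact hM x₀ e₀ he₀
      linarith
    · exact h
  -- the slice at `t₀`: `(x₀,e₀)` maximises, and the value exceeds `B(t₀)`
  have hE : 0 < w t₀ / B t₀ := by positivity
  have hxmax : ∀ (x : E) (e : E), ‖e‖ = 1 → ⟪W t₀ x e, e⟫ ≤ ⟪W t₀ x₀ e₀, e₀⟫ := fun x e he => by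
    have h := hglob t₀ ht₀ x e he
    have h' : w t₀ / B t₀ * ⟪W t₀ x e, e⟫ ≤ w t₀ / B t₀ * ⟪W t₀ x₀ e₀, e₀⟫ := by
      rw [div_mul_eq_mul_div, div_mul_eq_mul_div]; exact h
    exact le_of_mul_le_mul_left h' hE
  have hbig : B t₀ < ⟪W t₀ x₀ e₀, e₀⟫ := by
    have h1 : 1 < w t₀ * ⟪W t₀ x₀ e₀, e₀⟫ / B t₀ := hlt.trans_le hS'le
    have h2 : B t₀ < w t₀ * ⟪W t₀ x₀ e₀, e₀⟫ := by rwa [lt_div_iff₀ hB₀, one_mul] at h1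
    have hq0 : 0 < ⟪W t₀ x₀ e₀, e₀⟫ := by
      by_contra hneg
      push Not at hneg
      have : w t₀ * ⟪W t₀ x₀ e₀, e₀⟫ ≤ 0 := mul_nonpos_of_nonneg_of_nonpos (hwpos t₀).le hneg
      linarith
    have h3 : w t₀ * ⟪W t₀ x₀ e₀, e₀⟫ ≤ 1 * ⟪W t₀ x₀ e₀, e₀⟫ :=
      mul_le_mul_of_nonneg_right (hwle t₀ ht₀) hq0.le
    linarith
  have hinner : ⟪timeDerivWithin (Icc 0 T) W t₀ x₀ e₀, e₀⟫ ≤ φ t₀ * ⟪W t₀ x₀ e₀, e₀⟫ :=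
    hgrow t₀ ht₀ ht₀pos x₀ e₀ he₀ hxmax hbig
  -- one-sided Fermat in time for `k(s) = w(s)⟪W(s,x₀)e₀,e₀⟫/B(s)`
  have hγ : HasDerivWithinAt (fun s => W s x₀) (timeDerivWithin (Icc 0 T) W t₀ x₀) (Icc 0 T) t₀ := by
    rw [timeDerivWithin_apply]
    exact (hW.differentiableWithinAt_time ht₀ x₀).hasDerivWithinAt
  have hγe : HasDerivWithinAt (fun s => W s x₀ e₀) (timeDerivWithin (Icc 0 T) W t₀ x₀ e₀) (Icc 0 T) t₀ := by
    have h := hγ.clm_apply (hasDerivWithinAt_const t₀ (Icc 0 T) e₀)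
    simpa using h
  have hq : HasDerivWithinAt (fun s => ⟪W s x₀ e₀, e₀⟫)
      ⟪timeDerivWithin (Icc 0 T) W t₀ x₀ e₀, e₀⟫ (Icc 0 T) t₀ := by
    have h := hγe.inner ℝ (hasDerivWithinAt_const t₀ (Icc 0 T) e₀)
    simpa using h
  have hf : HasDerivWithinAt (fun s : ℝ => -(2 * ε * s)) (-(2 * ε)) (Icc 0 T) t₀ := by
    have h := ((hasDerivAt_id t₀).const_mul (2 * ε)).hasDerivWithinAt (s := Icc 0 T)
    simp only [id, mul_one] at h
    exact h.neg
  have hnum : HasDerivWithinAt (fun s => w s * ⟪W s x₀ e₀, e₀⟫)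
      (w t₀ * (-(2 * ε)) * ⟪W t₀ x₀ e₀, e₀⟫ +
        w t₀ * ⟪timeDerivWithin (Icc 0 T) W t₀ x₀ e₀, e₀⟫) (Icc 0 T) t₀ :=
    hf.exp.mul hq
  have hk := hnum.div (hBd t₀ ht₀) hB₀.ne'
  have htime := derivWithin_Icc_nonneg_of_forall_le ht₀ ht₀pos hk (fun s hs => hglob s hs x₀ e₀ he₀)
  -- the numerator is negative: contradiction
  set V : ℝ := ⟪W t₀ x₀ e₀, e₀⟫ with hV
  set I : ℝ := ⟪timeDerivWithin (Icc 0 T) W t₀ x₀ e₀, e₀⟫ with hI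
  have hVpos : 0 < V := hB₀.trans hbig
  have hsup : φ t₀ * B t₀ ≤ B' t₀ := hsuper t₀ ht₀
  have hnumneg : (w t₀ * (-(2 * ε)) * V + w t₀ * I) * B t₀ - w t₀ * V * B' t₀ < 0 := by
    have hw0 := hwpos t₀
    have h1 : I * B t₀ ≤ φ t₀ * V * B t₀ := by
      have := mul_le_mul_of_nonneg_right hinner hB₀.le
      rw [hI, hV]; linarith
    have h2 : φ t₀ * V * B t₀ ≤ V * B' t₀ := by
      have := mul_le_mul_of_nonneg_left hsup hVpos.le
      linarith
    have h3 : 0 < w t₀ * ε * V * B t₀ := by positivity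
    nlinarith [h1, h2, h3, hw0, hB₀, mul_le_mul_of_nonneg_left (h1.trans h2) hw0.le]
  have hderiv_neg : ((w t₀ * (-(2 * ε)) * V + w t₀ * I) * B t₀ - w t₀ * V * B' t₀) / B t₀ ^ 2 < 0 :=
    div_neg_of_neg_of_pos hnumneg (by positivity)
  exact absurd htime (not_le.2 hderiv_neg)

end AbstractStrain

end Summit.NavierStokesRegularity.NavierStokesRegularity.Theorems.ArgmaxDoors

end
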